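import Summits.HubbardSuperconductivity.HubbardSuperconductivity.Theses.ParentFirstSMA
import Literature.MathematicalPhysics.QuantumLattice.PairFieldEvenSideLRO
import HarnessLib

/-!
# Crux `DiluteDWavePairsCondense` (stmt-HubbardSuperconductivity-10771) — birth skeleton `Lines/birth.lean` (BC3; rev 1, lead c11: stub 3 reshaped)

Route `ParentFirstSMA` of `HubbardSuperconductivity/HubbardSuperconductivity`, crux of rank 4, concluded BY NAME:
`Summit.HubbardSuperconductivity.HubbardSuperconductivity.Theses.ParentFirstSMA.DiluteDWavePairsCondense` — the BEC
BRIDGE: for every `U ∈ [12, 24]`, (a) a charge-gapped half-filled parent, (b) L-uniform two-hole binding and (c)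
`d_{x²-y²}`-coherence of the bound pair imply `d`-wave pair-field long-range order of EVERY `(N_L(δ), S^z = 0)`
ground-state sequence along even sides at some doping `δ ∈ (0, 1/2)` (the summit's matrix at `(U, δ)`).

## The line: DILUTE PAIR GAS → YANG CONDENSATE OF PAIRS → SCALAPINO ORDER (Randeria–Duan–Shieh / Yang 1962)

The crux's conclusion is an `L → ∞` statement about `Δ_d = Σ_x P_x`; the line routes it through Yang's two-body
reduced density matrix `ρ₂(ψ_L)` (`twoParticleRDM`) of each finite-volume sector ground state, an object the crux
does not mention, in three physically distinct steps, each stated uniformly in `L` at finite volume: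

* `stub_pairingGapWindow` (ENERGETICS — "the doped holes form a gas of PAIRS"; size L): (a) + (b) ⇒ there is a
  doping window `(0, δ₀]` and `b' > 0` such that at EVERY even filling `N` with `(1-δ₀)L² ≤ N ≤ L²-2` of every
  large even torus the odd–even (one-quasiparticle / pair-breaking) gap is uniform:
  `b' ≤ E(N+1) + E(N-1) - 2E(N) = chargeGap … N`. Finite-density persistence of the two-hole bound state (b) in
  the dilute BEC regime (pair size ≪ interparticle distance, fermionic spectrum nodeless); ED/DMRG-testable
  (odd–even staggering of `E(N)` at small doping). Why it might fail: 3- and 4-hole clusters / stripe segments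
  binding more strongly than pairs, phase separation at `δ → 0⁺` (Emery–Kivelson–Lin), or the BCS-side nodal
  regime reaching down to every `δ₀`.
* `stub_pairCondensation` (CONDENSATION — the hard BEC step, symmetry-blind; size XL): (a) + a pairing-gap window
  `(0, δ₀]` ⇒ at SOME doping `δ ≤ δ₀` (`δ < 1/2`) EVERY normalised `(2⌊(1-δ)L²/2⌋, S^z = 0)` sector ground state of
  every large even torus has a macroscopically occupied pair mode: a unit `ρ₂`-eigenvector `v` with eigenvalue
  `ev ≥ c L²` (Yang ODLRO at finite volume, `c` uniform in `L` and in the ground state — the Koma–Tasaki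
  "every ground state" demand is met because `ρ₂`-eigenvalues are `U(1)`-invariant). The gapped fermions are
  what licenses the effective hard-core-boson description whose `T = 0` condensation in `d = 2` this asserts.
  Why it might fail: no `T = 0` BEC theorem for interacting 2D lattice bosons (only Kennedy–Lieb–Shastry at half
  filling by reflection positivity), phase separation / pair-density-wave / stripe ground states at the dopings
  where the pairs are gapped.
* `stub_condensateDWaveLocking` (SYMMETRY/STRUCTURE LOCKING — "the condensate is the `d_{x²-y²}` bound pair";
  size L; degeneracy-safe ∃-form since lead c11): (b) + (c) ⇒ on a doping window `(0, δ₁]`, for every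
  threshold `c > 0` there are `c' > 0`, `L₀` such that every sector ground state having a unit `ρ₂`-eigenvector
  with eigenvalue `≥ c L²` has such an eigenvector `v` that is SEEN by the nearest-neighbour `d`-wave pair
  field: `‖⟨v, φ_d⟩‖² ≥ c' L²` (`φ_d = pairFieldWavefunction dWaveFormFactor L`, `‖φ_d‖² = 4L²`). Excludes `s`/`p`/finite-momentum (PDW) condensates and fragmentation into `d`-orthogonal
  modes; inherits `B₁g` and the short pair size from the coherent two-hole bound state (c). ED-testable (top
  eigenvectors of `ρ₂` on 16–20-site clusters, Dagotto–Riera pair-susceptibility analyses). Why it might fail: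
  a degenerate macroscopic eigenvalue mixing channels, `p`-wave competition at `J/t ≤ 1/3`, PDW at `δ ≈ 1/8`.

Composition `DiluteDWavePairsCondense_of` (REAL proof, no `sorry`; literal shape
`stub₁-sig → stub₂-sig → stub₃-sig → DiluteDWavePairsCondense`): `δ* := min δ₀ δ₁` (the pairing-gap window
restricts downwards), condensation at some `δ ≤ δ*`, locking at that `δ` with the condensation threshold `c`;
then for each even side `n + 1 ≥ max L₀ L₀'` and each sector ground state: `Σ_{x,y} G_{n+1}(x,y) = re ⟨Δ_d† Δ_d⟩
= re (φ_d† ρ₂ φ_d)` (`sum_pairFieldCorr_succ`, `pairField_eq_pairAnnihilator_dWave`, Yang's identity)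
`≥ ev ‖⟨v, φ_d⟩‖²` (`re_dotProduct_mulVec_ge_of_eigenvector`, `ρ₂` a Gram matrix) `≥ (c L²)(c' L²)`, and the
tree's even-side bookkeeping `hasLongRangeOrder_even_of_le` (which carries the a-priori Cauchy–Schwarz ceiling
keeping Mathlib's real `liminf` off its junk value) gives `HasLongRangeOrder` along `k ↦ 2k` — the crux BY NAME.
All cited tree facts are sorry-free theorems of `Literature.MathematicalPhysics.QuantumLattice.PairCorrelationsProofs`
/ `PairFieldEvenSideLRO`.

Costume / shredding self-audit: no stub mentions `HasLongRangeOrder`, `pairFieldCorr` or the summit; stub 1 is an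
energetic statement (no order parameter at all), stub 2 has no `d`-wave information, stub 3 is conditional on a
macroscopic eigenvalue it does not assert; the BC3 probes `stub → DiluteDWavePairsCondense` and
`stub → HubbardSuperconductivity` by `first | exact? | simpa | aesop` fail for all three (NOTES.md of the
registrar). Typing checklist 4c: no Bochner integrals, no complex weights, the only thresholds are the route's own
window `12 ≤ U ≤ 24` and the summit's `δ < 1/2`; `L₀` is existential in every stub (small-torus degeneracies such
as `L = 0`, where no unit pair wavefunction exists, are excluded by it, not asserted).

Disproof used: none filed for this crux (`ledger crux ls stmt-HubbardSuperconductivity-10771`: no workfiles at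
registration, 2026-08-17). Negatives index (`ledger negatives --problem HubbardSuperconductivity`, 2 entries:
CooperPairDMottWalk breathing self-duality, AposterioriCapRg KLS openness): unrelated to all three stubs.
Refuter crux-attack record (CRUX-ATTACK.md, 2026-08-15): crux SURVIVES, "restates-target by design given the
0/1/2-hole inputs" — this skeleton is the requested one-level-down cut (route re-audit bin REPAIRABLE).

References: C. N. Yang, Rev. Mod. Phys. 34 (1962) 694, §4; D. J. Scalapino, Phys. Rep. 250 (1995) 329, §2;
M. Randeria, J.-M. Duan, L.-Y. Shieh, Phys. Rev. Lett. 62 (1989) 981; V. J. Emery, S. A. Kivelson, H. Q. Lin,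
Phys. Rev. Lett. 64 (1990) 475; E. Dagotto, Rev. Mod. Phys. 66 (1994) 763; T. Kennedy, E. H. Lieb,
B. S. Shastry, Phys. Rev. Lett. 61 (1988) 2582; T. Koma, H. Tasaki, J. Stat. Phys. 76 (1994) 745.
-/

noncomputable section

namespace Summit.HubbardSuperconductivity.HubbardSuperconductivity.Cruxes.DiluteDWavePairsCondense.Birth

open Matrix Finset Filter
open Literature.Probability.LatticeModels Literature.MathematicalPhysics.QuantumLattice
open scoped ComplexOrder

/-- **Stub 1 — pairing-gap window (finite-density pair formation; size L).** For `U ∈ [12, 24]`: a uniform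
charge gap of the half-filled parent (a) and uniform two-hole binding (b) imply a doping window `(0, δ₀]` and a
uniform odd–even gap `b' > 0`: `b' ≤ E(N+1) + E(N-1) - 2E(N)` (`= chargeGap (fermionTorusGraph 2 L) 1 U N`) for
every even `N` with `(1-δ₀)L² ≤ N ≤ L² - 2` on every large even torus (all doped holes are paired; dilute BEC
regime). [cite: RanderiaDuanShieh1989; doi:10.1103/RevModPhys.66.763, §IV; doi:10.1103/PhysRevLett.64.475] -/
theorem stub_pairingGapWindow : ∀ U : ℝ, 12 ≤ U → U ≤ 24 → (∃ g : ℝ, 0 < g ∧ ∃ L₀ : ℕ, ∀ L : ℕ, L₀ ≤ L → Even L → g ≤ chargeGap (fermionTorusGraph 2 L) 1 U (L ^ 2)) → (∃ b : ℝ, 0 < b ∧ ∃ L₀ : ℕ, ∀ L : ℕ, L₀ ≤ L → Even L → b ≤ 2 * groundEnergyAt (fermionTorusGraph 2 L) 1 U (L ^ 2 - 1) - groundEnergyAt (fermionTorusGraph 2 L) 1 U (L ^ 2) - groundEnergyAt (fermionTorusGraph 2 L) 1 U (L ^ 2 - 2)) → ∃ δ₀ : ℝ, 0 < δ₀ ∧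 ∃ b' : ℝ, 0 < b' ∧ (∃ L₀ : ℕ, ∀ L : ℕ, L₀ ≤ L → Even L → ∀ N : ℕ, Even N → (1 - δ₀) * (L : ℝ) ^ 2 ≤ N → N + 2 ≤ L ^ 2 → b' ≤ chargeGap (fermionTorusGraph 2 L) 1 U N) := by
  sorry

/-- **Stub 2 — condensation of the gapped pair gas (Yang ODLRO in every sector ground state; size XL).** For
`U ∈ [12, 24]`: a charge-gapped parent (a) and a pairing-gap window `(0, δ₀]` with margin `b'` imply that at some
doping `0 < δ ≤ δ₀`, `δ < 1/2`, with a constant `c > 0` uniform in `L`, every normalised ground state of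
`hubbardTorus 2 L 1 U` in the sector `(2⌊(1-δ)L²/2⌋, S^z = 0)`, `L ≥ L₀` even, has a unit `ρ₂`-eigenvector with
eigenvalue `≥ c L²` (a macroscopically occupied pair mode). [cite: Yang1962, §4; KomaTasaki1994;
KennedyLiebShastry1988; LiebSeiringer2002] -/
theorem stub_pairCondensation : ∀ U : ℝ, 12 ≤ U → U ≤ 24 → (∃ g : ℝ, 0 < g ∧ ∃ L₀ : ℕ, ∀ L : ℕ, L₀ ≤ L → Even L → g ≤ chargeGap (fermionTorusGraph 2 L) 1 U (L ^ 2)) → ∀ δ₀ b' : ℝ, 0 < δ₀ → 0 < b' → (∃ L₀ : ℕ, ∀ L : ℕ, L₀ ≤ L → Even L → ∀ N : ℕ, Even N → (1 - δ₀) * (L : ℝ) ^ 2 ≤ N → N + 2 ≤ L ^ 2 → b' ≤ chargeGap (fermionTorusGraph 2 L) 1 U N) → ∃ δ : ℝ, 0 < δ ∧ δ ≤ δ₀ ∧ δ < 1 / 2 ∧ ∃ c : ℝ, 0 < c ∧ ∃ L₀ : ℕ, ∀ L : ℕ, L₀ ≤ L → Even L → ∀ ψ : Fock (Orb (FermionTorus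 2 L)), star ψ ⬝ᵥ ψ = 1 → IsGroundStateInSector (hubbardTorus 2 L 1 U) (2 * ⌊(1 - δ) * (L : ℝ) ^ 2 / 2⌋₊) 0 ψ → ∃ v : Orb (FermionTorus 2 L) × Orb (FermionTorus 2 L) → ℂ, ∃ ev : ℝ, star v ⬝ᵥ v = 1 ∧ twoParticleRDM ψ *ᵥ v = (ev : ℂ) • v ∧ c * (L : ℝ) ^ 2 ≤ ev := by
  sorry

/-- **Stub 3 — `d_{x²-y²}` locking of the condensate wavefunction (size L; degeneracy-safe existential form,
lead c11 reshape 2026-08-17).** For `U ∈ [12, 24]`: two-hole binding (b) and `d`-coherence of the bound pair (c)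
imply a doping window `(0, δ₁]` on which, for every threshold `c > 0`, eventually in even `L`, every normalised
`(2⌊(1-δ)L²/2⌋, S^z = 0)` sector ground state that HAS a unit `ρ₂`-eigenvector with eigenvalue `≥ c L²` has one
(possibly another vector of the same macroscopic eigenspaces) which the nearest-neighbour `d`-wave pair wavefunction
sees macroscopically: `c' L² ≤ ‖⟨v, φ_d⟩‖²`. (The registered rev-0 form quantified over EVERY such eigenvector,
which fails as soon as a macroscopic eigenvalue is degenerate — its eigenspace then contains a unit vector
orthogonal to `φ_d`; the composition only ever needed one eigenpair.) [cite: Scalapino1995, §2;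
doi:10.1103/RevModPhys.66.763, §IV.C; doi:10.1103/PhysRevB.55.6504] -/
theorem stub_condensateDWaveLocking : ∀ U : ℝ, 12 ≤ U → U ≤ 24 → (∃ b : ℝ, 0 < b ∧ ∃ L₀ : ℕ, ∀ L : ℕ, L₀ ≤ L → Even L → b ≤ 2 * groundEnergyAt (fermionTorusGraph 2 L) 1 U (L ^ 2 - 1) - groundEnergyAt (fermionTorusGraph 2 L) 1 U (L ^ 2) - groundEnergyAt (fermionTorusGraph 2 L) 1 U (L ^ 2 - 2)) → (∃ z : ℝ, 0 < z ∧ ∃ L₀ : ℕ, ∀ (L : ℕ) [NeZero L], L₀ ≤ L → Even L → ∃ φ₂ ψ₀ : Fock (Orb (FermionTorus 2 L)), IsGroundState (hubbardTorus 2 L 1 U) (L ^ 2 - 2) φ₂ ∧ star φ₂ ⬝ᵥ φ₂ = 1 ∧ IsGroundState (hubbardTorus 2 L 1 U) (L ^ 2) ψ₀ ∧ star ψ₀ ⬝ᵥ ψ₀ = 1 ∧ z * (L : ℝ) ^ 2 ≤ ‖star φ₂ ⬝ᵥ (pairField dWaveFormFactor L *ᵥ ψ₀)‖ ^ 2) →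 ∃ δ₁ : ℝ, 0 < δ₁ ∧ ∀ δ : ℝ, 0 < δ → δ ≤ δ₁ → ∀ c : ℝ, 0 < c → ∃ c' : ℝ, 0 < c' ∧ ∃ L₀ : ℕ, ∀ (L : ℕ) [NeZero L], L₀ ≤ L → Even L → ∀ ψ : Fock (Orb (FermionTorus 2 L)), star ψ ⬝ᵥ ψ = 1 → IsGroundStateInSector (hubbardTorus 2 L 1 U) (2 * ⌊(1 - δ) * (L : ℝ) ^ 2 / 2⌋₊) 0 ψ → (∃ v : Orb (FermionTorus 2 L) × Orb (FermionTorus 2 L) → ℂ, ∃ ev : ℝ, star v ⬝ᵥ v = 1 ∧ twoParticleRDM ψ *ᵥ v = (ev : ℂ) • v ∧ c * (L : ℝ) ^ 2 ≤ ev) → ∃ v : Orb (FermionTorus 2 L) × Orb (FermionTorus 2 L) → ℂ, ∃ ev : ℝ, star v ⬝ᵥ v = 1 ∧ twoParticleRDM ψ *ᵥ v = (ev : ℂ) • v ∧ c * (L : ℝ) ^ 2 ≤ ev ∧ c' * (L : ℝ) ^ 2 ≤ ‖star v ⬝ᵥ pairFieldWavefunction dWaveFormFactor L‖ ^ 2 :=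 by
  sorry

/-! ### Named twins of the stub signatures and the skeleton theorem

The composition is stated over the named twins `Sig.stub_*` (definitionally the stub statements, same text — the
`example` at the end feeds the sorried stubs through it, which certifies the texts agree), so that its type has the
literal shape `stub₁-sig → stub₂-sig → stub₃-sig → DiluteDWavePairsCondense` AND every hypothesis is a named
proposition keyed by the stub name (A12 `#h21_check_skeleton` admissibility). Obligation attributes are gate-reserved
in workfiles, so no tag is applied here. -/

/-- Named twin of stub 1 (same text; its last name component is the stub name, so the A12 skeleton audit admits it as a hypothesis). [folklore] -/
def Sig.stub_pairingGapWindow : Prop := ∀ U : ℝ, 12 ≤ U → U ≤ 24 → (∃ g : ℝ, 0 < g ∧ ∃ L₀ : ℕ, ∀ L : ℕ, L₀ ≤ L → Even L → g ≤ chargeGap (fermionTorusGraph 2 L) 1 U (L ^ 2)) → (∃ b : ℝ, 0 < b ∧ ∃ L₀ : ℕ, ∀ L : ℕ, L₀ ≤ L → Even L → b ≤ 2 * groundEnergyAt (fermionTorusGraph 2 L) 1 U (L ^ 2 - 1) - groundEnergyAt (fermionTorusGraph 2 L) 1 U (L ^ 2) - groundEnergyAt (fermionTorusGraph 2 L) 1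 U (L ^ 2 - 2)) → ∃ δ₀ : ℝ, 0 < δ₀ ∧ ∃ b' : ℝ, 0 < b' ∧ (∃ L₀ : ℕ, ∀ L : ℕ, L₀ ≤ L → Even L → ∀ N : ℕ, Even N → (1 - δ₀) * (L : ℝ) ^ 2 ≤ N → N + 2 ≤ L ^ 2 → b' ≤ chargeGap (fermionTorusGraph 2 L) 1 U N)

/-- Named twin of stub 2 (same text). [folklore] -/
def Sig.stub_pairCondensation : Prop := ∀ U : ℝ, 12 ≤ U → U ≤ 24 → (∃ g : ℝ, 0 < g ∧ ∃ L₀ : ℕ, ∀ L : ℕ, L₀ ≤ L → Even L → g ≤ chargeGap (fermionTorusGraph 2 L) 1 U (L ^ 2)) → ∀ δ₀ b' : ℝ, 0 < δ₀ → 0 < b' → (∃ L₀ : ℕ, ∀ L : ℕ, L₀ ≤ L → Even L → ∀ N : ℕ, Even N → (1 - δ₀) * (L : ℝ) ^ 2 ≤ N → N + 2 ≤ L ^ 2 → b' ≤ chargeGap (fermionTorusGraph 2 L) 1 U N) → ∃ δ : ℝ, 0 < δ ∧ δ ≤ δ₀ ∧ δ < 1 / 2 ∧ ∃ c : ℝ,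 0 < c ∧ ∃ L₀ : ℕ, ∀ L : ℕ, L₀ ≤ L → Even L → ∀ ψ : Fock (Orb (FermionTorus 2 L)), star ψ ⬝ᵥ ψ = 1 → IsGroundStateInSector (hubbardTorus 2 L 1 U) (2 * ⌊(1 - δ) * (L : ℝ) ^ 2 / 2⌋₊) 0 ψ → ∃ v : Orb (FermionTorus 2 L) × Orb (FermionTorus 2 L) → ℂ, ∃ ev : ℝ, star v ⬝ᵥ v = 1 ∧ twoParticleRDM ψ *ᵥ v = (ev : ℂ) • v ∧ c * (L : ℝ) ^ 2 ≤ ev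

/-- Named twin of stub 3 (same text). [folklore] -/
def Sig.stub_condensateDWaveLocking : Prop := ∀ U : ℝ, 12 ≤ U → U ≤ 24 → (∃ b : ℝ, 0 < b ∧ ∃ L₀ : ℕ, ∀ L : ℕ, L₀ ≤ L → Even L → b ≤ 2 * groundEnergyAt (fermionTorusGraph 2 L) 1 U (L ^ 2 - 1) - groundEnergyAt (fermionTorusGraph 2 L) 1 U (L ^ 2) - groundEnergyAt (fermionTorusGraph 2 L) 1 U (L ^ 2 - 2)) → (∃ z : ℝ, 0 < z ∧ ∃ L₀ : ℕ, ∀ (L : ℕ) [NeZero L], L₀ ≤ L → Even L → ∃ φ₂ ψ₀ : Fock (Orb (FermionTorus 2 L)), IsGroundState (hubbardTorus 2 L 1 U) (L ^ 2 - 2) φ₂ ∧ star φ₂ ⬝ᵥ φ₂ = 1 ∧ IsGroundState (hubbardTorus 2 L 1 U) (L ^ 2) ψ₀ ∧ star ψ₀ ⬝ᵥ ψ₀ = 1 ∧ z * (L : ℝ) ^ 2 ≤ ‖star φ₂ ⬝ᵥ (pairField dWaveFormFactor L *ᵥ ψ₀)‖ ^ 2) → ∃ δ₁ : ℝ, 0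 < δ₁ ∧ ∀ δ : ℝ, 0 < δ → δ ≤ δ₁ → ∀ c : ℝ, 0 < c → ∃ c' : ℝ, 0 < c' ∧ ∃ L₀ : ℕ, ∀ (L : ℕ) [NeZero L], L₀ ≤ L → Even L → ∀ ψ : Fock (Orb (FermionTorus 2 L)), star ψ ⬝ᵥ ψ = 1 → IsGroundStateInSector (hubbardTorus 2 L 1 U) (2 * ⌊(1 - δ) * (L : ℝ) ^ 2 / 2⌋₊) 0 ψ → (∃ v : Orb (FermionTorus 2 L) × Orb (FermionTorus 2 L) → ℂ, ∃ ev : ℝ, star v ⬝ᵥ v = 1 ∧ twoParticleRDM ψ *ᵥ v = (ev : ℂ) • v ∧ c * (L : ℝ) ^ 2 ≤ ev) → ∃ v : Orb (FermionTorus 2 L) × Orb (FermionTorus 2 L) → ℂ, ∃ ev : ℝ, star v ⬝ᵥ v = 1 ∧ twoParticleRDM ψ *ᵥ v = (ev : ℂ) • v ∧ c * (L : ℝ) ^ 2 ≤ ev ∧ c' * (L : ℝ) ^ 2 ≤ ‖star v ⬝ᵥ pairFieldWavefunction dWaveFormFactor L‖ ^ 2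

/-- **Skeleton theorem (composition PROVED; the only sorries of this file are the three stubs, consumed once each by
the `example` below).** Literal shape `stub₁-sig → stub₂-sig → stub₃-sig → DiluteDWavePairsCondense`, concluded BY
NAME. [folklore] -/
theorem DiluteDWavePairsCondense_of :
    Sig.stub_pairingGapWindow → Sig.stub_pairCondensation → Sig.stub_condensateDWaveLocking →
    Summit.HubbardSuperconductivity.HubbardSuperconductivity.Theses.ParentFirstSMA.DiluteDWavePairsCondense := by
  intro h₁ h₂ h₃ U hU12 hU24 hA hB hC
  simp only [Sig.stub_pairingGapWindow, Sig.stub_pairCondensation, Sig.stub_condensateDWaveLocking] at h₁ h₂ h₃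
  -- Stub 1: the pairing-gap window `(0, δ₀]` with margin `b'`
  obtain ⟨δ₀, hδ₀, b', hb', L₁, hW⟩ := h₁ U hU12 hU24 hA hB
  -- Stub 3: the locking window `(0, δ₁]`
  obtain ⟨δ₁, hδ₁, hLock⟩ := h₃ U hU12 hU24 hB hC
  -- restrict the pairing-gap window to `δ* = min δ₀ δ₁`
  have hW' : ∃ L₀ : ℕ, ∀ L : ℕ, L₀ ≤ L → Even L → ∀ N : ℕ, Even N →
      (1 - min δ₀ δ₁) * (L : ℝ) ^ 2 ≤ N → N + 2 ≤ L ^ 2 → b' ≤ chargeGap (fermionTorusGraph 2 L) 1 U N := by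
    refine ⟨L₁, fun L hL hLe N hNe hlo hhi => hW L hL hLe N hNe (le_trans ?_ hlo) hhi⟩
    have hm : min δ₀ δ₁ ≤ δ₀ := min_le_left _ _
    have hL2 : (0 : ℝ) ≤ (L : ℝ) ^ 2 := by positivity
    nlinarith
  -- Stub 2: condensation at some `δ ≤ δ*`
  obtain ⟨δ, hδ, hδle, hδhalf, c, hc, L₂, hCond⟩ :=
    h₂ U hU12 hU24 hA (min δ₀ δ₁) b' (lt_min hδ₀ hδ₁) hb' hW'
  -- Stub 3 at this `δ` and at the condensation threshold `c`
  obtain ⟨c', hc', L₃, hLock'⟩ := hLock δ hδ (hδle.trans (min_le_right _ _)) c hc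
  refine ⟨δ, ⟨hδ, hδhalf⟩, ?_⟩
  intro N ψ hseq
  -- even-side LRO bookkeeping (tree): it suffices to bound `Σ_{x,y} G_{n+1}(x,y)` below by `(c c') (n+1)⁴`
  refine hasLongRangeOrder_even_of_le dWaveFormFactor ψ (fun n hn => (hseq (n + 1) hn).2.1)
    (a := c * c') (mul_pos hc hc') (max L₂ L₃) ?_
  intro n hn hK
  obtain ⟨hN, hnorm, hGS⟩ := hseq (n + 1) hn
  rw [hN] at hGS
  have hL₂ : L₂ ≤ n + 1 := le_trans (le_max_left _ _) hK
  have hL₃ : L₃ ≤ n + 1 := le_trans (le_max_right _ _) hK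
  obtain ⟨v, ev, hv1, hev, hcL, hov⟩ :=
    hLock' (n + 1) hL₃ hn (ψ (n + 1)) hnorm hGS (hCond (n + 1) hL₂ hn (ψ (n + 1)) hnorm hGS)
  -- `Σ_{x,y} G = re ⟨Δ_d† Δ_d⟩ = re (φ_d† ρ₂ φ_d)`
  rw [sum_pairFieldCorr_succ dWaveFormFactor ψ n,
    expect_pairField_eq_dotProduct_twoParticleRDM dWaveFormFactor (n + 1)
      expect_pairAnnihilator_conjTranspose_mul_holds (pairField_eq_pairAnnihilator_dWave (n + 1))]
  -- Yang: `ev ‖⟨v, φ_d⟩‖² ≤ re (φ_d† ρ₂ φ_d)` for the unit eigenvector `v` of the Gram matrix `ρ₂`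
  have hkey := re_dotProduct_mulVec_ge_of_eigenvector
    (fun u : Orb (FermionTorus 2 (n + 1)) × Orb (FermionTorus 2 (n + 1)) → ℂ =>
      pairAnnihilator u *ᵥ ψ (n + 1))
    (fun x y => by simp only [pairAnnihilator_add, add_mulVec])
    (fun a x => by simp only [pairAnnihilator_smul, smul_mulVec])
    (twoParticleRDM (ψ (n + 1))) (star_dotProduct_twoParticleRDM_mulVec (ψ (n + 1))) v
    (pairFieldWavefunction dWaveFormFactor (n + 1)) ev hv1 hev
  have hcL0 : (0 : ℝ) ≤ c * ((n + 1 : ℕ) : ℝ) ^ 2 := by positivity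
  have hev0 : (0 : ℝ) ≤ ev := le_trans hcL0 hcL
  calc c * c' * ((n + 1 : ℕ) : ℝ) ^ 4
      = (c * ((n + 1 : ℕ) : ℝ) ^ 2) * (c' * ((n + 1 : ℕ) : ℝ) ^ 2) := by ring
    _ ≤ ev * ‖star v ⬝ᵥ pairFieldWavefunction dWaveFormFactor (n + 1)‖ ^ 2 :=
        mul_le_mul hcL hov (by positivity) hev0
    _ ≤ _ := hkey

/-! The registered stubs feed the skeleton theorem (the only place the sorried stubs are consumed; it also
certifies that the composition's binder types are the stub signatures verbatim). -/
example : Summit.HubbardSuperconductivity.HubbardSuperconductivity.Theses.ParentFirstSMA.DiluteDWavePairsCondense :=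
  DiluteDWavePairsCondense_of stub_pairingGapWindow stub_pairCondensation stub_condensateDWaveLocking

end Summit.HubbardSuperconductivity.HubbardSuperconductivity.Cruxes.DiluteDWavePairsCondense.Birth

end
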